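import Summits.Ventures.HodgeRepro2.T5AutomorphizeContinuous
import Summits.Ventures.HodgeRepro2.T5KernelOperatorCompact

/-!
# T5AutomorphizeKernel — the two-variable kernel `Σ_γ f(x γ y⁻¹)` is a continuous function on
`(G ⧸ Γ) × (G ⧸ Γ)`, and its integral operator is compact ([DE] Lemma 9.2.3, second half, and
Lemma 9.2.4 applied)

Cell pub-hodge-repro2, seat p5, Tier 5 (route/T5-N4-p5.md, N4.3 v13 (B1)–(B2)).  Row 55 made the
one-variable automorphization `Σ_γ f(xγ)` of `f ∈ C_c(G)` along a discrete `Γ` locally finite and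
continuous.  [DE] Lemma 9.2.3 needs the TWO-variable kernel of `η(f)`; in Mathlib's conventions
(left cosets `G ⧸ Γ`, `Γ` acting on the right through `Γ.op`, the left regular representation
`(L(f)φ)(x̄) = ∫_G f(g) φ(g⁻¹x̄) dg = ∫_G f(x y⁻¹) φ(ȳ) dy`) it is

  `kernelFun Γ f (x, y) := ∑' γ : Γ.op, f (x * (γ • y)⁻¹) = Σ_{γ ∈ Γ} f (x γ⁻¹ y⁻¹)`.

This file, on top of rows 54–55:

* `finite_setOf_exists_kernel` / `kernelFun_eq_sum_on`: **local finiteness in two variables** —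
  on `L × L'` (compact) only the `γ` with `γ • L' ∩ (tsupport f)⁻¹ L ≠ ∅` contribute (finitely many
  by proper discontinuity), so the kernel is a finite sum there;
* `continuous_kernelFun`: **joint continuity** on `G × G`;
* `kernelFun_mul_right` / `kernelFun_mul_left`: **`Γ × Γ`-invariance** (reindexing the sum);
* `kernelQuot` / `continuous_kernelQuot` / `kernelCont`: the **descent** to a continuous function
  on `(G ⧸ Γ) × (G ⧸ Γ)` (Mathlib's open quotient map `G → G ⧸ Γ`, `IsOpenQuotientMap.prodMap`),
  packaged as `kernelCont … : C((G ⧸ Γ) × (G ⧸ Γ), ℂ)`;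
* `isCompactOperator_integralOp_kernelCont`: for a COCOMPACT `Γ` (`CompactSpace (G ⧸ Γ)`) and a
  finite Borel measure on the quotient, row 54's integral operator of this kernel is a **compact
  operator on `L²(G ⧸ Γ)`** — [DE] Lemma 9.2.4 applied to the kernel of Lemma 9.2.3.

What stays prose [C] after this file is the identity `η(f) = integralOp (kernelCont …)` on
`L²(G ⧸ Γ, μ_𝓕)` (Mathlib's unfolding trick `QuotientGroup.integral_mul_eq_integral_automorphize_mul`
on the quotient measure of a fundamental domain) — and the convention gap between [DE]'s right
cosets `Γ\G` and Mathlib's left cosets `G ⧸ Γ` (the inversion), recorded, not bridged.  Mathlib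
only besides rows 54–55.  Axioms: propext, Classical.choice, Quot.sound.  README §8(d): uses an
L-value-free non-vanishing device: NO.
-/

namespace Summit.Ventures.HodgeRepro2.T5AutomorphizeKernel

open Filter Topology Set MeasureTheory
open Summit.Ventures.HodgeRepro2.T5AutomorphizeContinuous
open Summit.Ventures.HodgeRepro2.T5KernelOperatorCompact

variable {G : Type*} [Group G] [TopologicalSpace G] [IsTopologicalGroup G] {Γ : Subgroup G}

/-! ### The two-variable kernel on `G × G` -/

/-- The kernel `(x, y) ↦ Σ_{γ ∈ Γ} f (x γ⁻¹ y⁻¹) = ∑' γ : Γ.op, f (x * (γ • y)⁻¹)` — the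
automorphization in `y` of `y ↦ f (x y⁻¹)`. -/
noncomputable def kernelFun (Γ : Subgroup G) (f : G → ℂ) : G × G → ℂ :=
  fun p => ∑' γ : Γ.op, f (p.1 * (γ • p.2)⁻¹)

omit [TopologicalSpace G] [IsTopologicalGroup G] in
/-- `kernelFun Γ f (x, y)` is `autoFun Γ (fun z => f (x * z⁻¹)) y`. -/
theorem kernelFun_eq_autoFun (f : G → ℂ) (x y : G) :
    kernelFun Γ f (x, y) = autoFun Γ (fun z => f (x * z⁻¹)) y :=
  rfl

omit [IsTopologicalGroup G] in
/-- **Local finiteness in two variables**: for compact `L`, `L'` only finitely many `γ` have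
`f (x * (γ • y)⁻¹) ≠ 0` for some `(x, y) ∈ L × L'` (those with `γ • L' ∩ (tsupport f)⁻¹ L ≠ ∅`). -/
theorem finite_setOf_exists_kernel [ContinuousMul G] [ContinuousInv G]
    [ProperlyDiscontinuousSMul Γ.op G] {f : G → ℂ} (hf : HasCompactSupport f) {L L' : Set G}
    (hL : IsCompact L) (hL' : IsCompact L') :
    {γ : Γ.op | ∃ x ∈ L, ∃ y ∈ L', f (x * (γ • y)⁻¹) ≠ 0}.Finite := by
  have hK : IsCompact (tsupport f) := hf
  refine (ProperlyDiscontinuousSMul.finite_disjoint_inter_image hL' (hK.inv.mul hL)).subset ?_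
  rintro γ ⟨x, hxL, y, hyL', hxy⟩
  refine ⟨γ • y, ⟨y, hyL', rfl⟩, ?_⟩
  have h1 : x * (γ • y)⁻¹ ∈ tsupport f := subset_tsupport f hxy
  have h2 : γ • y = (x * (γ • y)⁻¹)⁻¹ * x := by group
  rw [h2]
  exact Set.mul_mem_mul (Set.inv_mem_inv.2 h1) hxL

omit [IsTopologicalGroup G] in
/-- On `L × L'` the kernel is the FINITE sum over the contributing `γ`. -/
theorem kernelFun_eq_sum_on [ContinuousMul G] [ContinuousInv G]
    [ProperlyDiscontinuousSMul Γ.op G] {f : G → ℂ} (hf : HasCompactSupport f) {L L' : Set G}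
    (hL : IsCompact L) (hL' : IsCompact L') {x y : G} (hx : x ∈ L) (hy : y ∈ L') :
    kernelFun Γ f (x, y) =
      ∑ γ ∈ (finite_setOf_exists_kernel (Γ := Γ) hf hL hL').toFinset, f (x * (γ • y)⁻¹) := by
  unfold kernelFun
  refine tsum_eq_sum fun γ hγ => ?_
  by_contra h
  exact hγ ((finite_setOf_exists_kernel (Γ := Γ) hf hL hL').mem_toFinset.2 ⟨x, hx, y, hy, h⟩)

/-- Each term `(x, y) ↦ f (x * (γ • y)⁻¹)` is continuous. -/
theorem continuous_kernel_term {f : G → ℂ} (hfc : Continuous f) (γ : Γ.op) :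
    Continuous fun p : G × G => f (p.1 * (γ • p.2)⁻¹) := by
  have h : (fun p : G × G => f (p.1 * (γ • p.2)⁻¹)) =
      fun p : G × G => f (p.1 * (p.2 * (γ : Gᵐᵒᵖ).unop)⁻¹) :=
    funext fun p => by rw [op_smul_apply]
  rw [h]
  exact hfc.comp (continuous_fst.mul (continuous_snd.mul continuous_const).inv)

/-- **Joint continuity of the kernel** on `G × G` (`Γ.op` properly discontinuous, `G` weakly
locally compact): near every point it is a finite sum of continuous functions. -/
theorem continuous_kernelFun [WeaklyLocallyCompactSpace G] [ProperlyDiscontinuousSMul Γ.op G]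
    {f : G → ℂ} (hfc : Continuous f) (hfs : HasCompactSupport f) :
    Continuous (kernelFun Γ f) := by
  rw [continuous_iff_continuousAt]
  rintro ⟨x₀, y₀⟩
  obtain ⟨L, hL, hLx⟩ := exists_compact_mem_nhds x₀
  obtain ⟨L', hL', hLy⟩ := exists_compact_mem_nhds y₀
  have hsum : Continuous fun p : G × G =>
      ∑ γ ∈ (finite_setOf_exists_kernel (Γ := Γ) hfs hL hL').toFinset, f (p.1 * (γ • p.2)⁻¹) :=
    continuous_finsetSum _ fun γ _ => continuous_kernel_term hfc γ
  refine hsum.continuousAt.congr ?_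
  filter_upwards [prod_mem_nhds hLx hLy] with p hp
  exact (kernelFun_eq_sum_on hfs hL hL' hp.1 hp.2).symm

/-! ### `Γ × Γ`-invariance -/

omit [TopologicalSpace G] [IsTopologicalGroup G] in
/-- Invariance in the second variable: `kernelFun Γ f (x, y * γ) = kernelFun Γ f (x, y)`. -/
theorem kernelFun_mul_right (f : G → ℂ) (x y : G) {γ : G} (hγ : γ ∈ Γ) :
    kernelFun Γ f (x, y * γ) = kernelFun Γ f (x, y) :=
  autoFun_mul_mem (fun z => f (x * z⁻¹)) y hγ

omit [TopologicalSpace G] [IsTopologicalGroup G] in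
/-- Invariance in the first variable: `kernelFun Γ f (x * γ, y) = kernelFun Γ f (x, y)` (reindex
the sum by `δ ↦ (op γ)⁻¹ * δ`). -/
theorem kernelFun_mul_left (f : G → ℂ) (x y : G) {γ : G} (hγ : γ ∈ Γ) :
    kernelFun Γ f (x * γ, y) = kernelFun Γ f (x, y) := by
  unfold kernelFun
  set g : Γ.op := ⟨MulOpposite.op γ, Subgroup.mem_op.2 (by simpa using hγ)⟩ with hg
  have hg' : ∀ z : G, g⁻¹ • z = z * γ⁻¹ := fun z => by
    rw [op_smul_apply, Subgroup.coe_inv, MulOpposite.unop_inv]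
    rfl
  have := (Equiv.mulLeft g⁻¹).tsum_eq fun δ : Γ.op => f (x * (δ • y)⁻¹)
  simpa only [Equiv.coe_mulLeft, mul_smul, hg', mul_inv_rev, inv_inv, mul_assoc] using this

/-! ### Descent to `(G ⧸ Γ) × (G ⧸ Γ)` -/

omit [TopologicalSpace G] [IsTopologicalGroup G] in
/-- The kernel descends to the quotient: `kernelQuot Γ f (x̄, ȳ) = kernelFun Γ f (x, y)`. -/
noncomputable def kernelQuot (Γ : Subgroup G) (f : G → ℂ) : G ⧸ Γ → G ⧸ Γ → ℂ :=
  Quotient.lift₂ (fun x y => kernelFun Γ f (x, y)) (by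
    intro x₁ y₁ x₂ y₂ hx hy
    have hx' : x₁⁻¹ * x₂ ∈ Γ := QuotientGroup.leftRel_apply.1 hx
    have hy' : y₁⁻¹ * y₂ ∈ Γ := QuotientGroup.leftRel_apply.1 hy
    have e1 : x₂ = x₁ * (x₁⁻¹ * x₂) := by group
    have e2 : y₂ = y₁ * (y₁⁻¹ * y₂) := by group
    rw [e1, e2, kernelFun_mul_left _ _ _ hx', kernelFun_mul_right _ _ _ hy'])

omit [TopologicalSpace G] [IsTopologicalGroup G] in
/-- `kernelQuot` on classes. -/
theorem kernelQuot_mk (f : G → ℂ) (x y : G) :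
    kernelQuot Γ f (x : G ⧸ Γ) (y : G ⧸ Γ) = kernelFun Γ f (x, y) :=
  rfl

/-- **Continuity on the quotient**: `(x̄, ȳ) ↦ kernelQuot Γ f x̄ ȳ` is continuous on
`(G ⧸ Γ) × (G ⧸ Γ)` (the product of two open quotient maps is a quotient map). -/
theorem continuous_kernelQuot [WeaklyLocallyCompactSpace G] [ProperlyDiscontinuousSMul Γ.op G]
    {f : G → ℂ} (hfc : Continuous f) (hfs : HasCompactSupport f) :
    Continuous fun p : (G ⧸ Γ) × (G ⧸ Γ) => kernelQuot Γ f p.1 p.2 := by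
  rw [(QuotientGroup.isOpenQuotientMap_mk.prodMap
    QuotientGroup.isOpenQuotientMap_mk).isQuotientMap.continuous_iff]
  exact continuous_kernelFun hfc hfs

/-- **The kernel of [DE] Lemma 9.2.3 as a continuous function** on `(G ⧸ Γ) × (G ⧸ Γ)`. -/
noncomputable def kernelCont [WeaklyLocallyCompactSpace G] [ProperlyDiscontinuousSMul Γ.op G]
    {f : G → ℂ} (hfc : Continuous f) (hfs : HasCompactSupport f) :
    C((G ⧸ Γ) × (G ⧸ Γ), ℂ) :=
  ⟨fun p => kernelQuot Γ f p.1 p.2, continuous_kernelQuot hfc hfs⟩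

/-- `kernelCont` on classes. -/
theorem kernelCont_apply_mk [WeaklyLocallyCompactSpace G] [ProperlyDiscontinuousSMul Γ.op G]
    {f : G → ℂ} (hfc : Continuous f) (hfs : HasCompactSupport f) (x y : G) :
    kernelCont hfc hfs ((x : G ⧸ Γ), (y : G ⧸ Γ)) = kernelFun Γ f (x, y) :=
  rfl

/-! ### The integral operator of the kernel is compact (cocompact `Γ`) -/

/-- **[DE] Lemma 9.2.4 applied to the kernel of Lemma 9.2.3**: for a COCOMPACT `Γ` and a finite
Borel measure `μ` on `G ⧸ Γ`, the integral operator `v ↦ (x̄ ↦ ∫ kernelQuot Γ f x̄ ȳ · v ȳ dμ)` of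
row 54 is a compact operator on `L²(G ⧸ Γ, μ)`. -/
theorem isCompactOperator_integralOp_kernelCont [WeaklyLocallyCompactSpace G]
    [ProperlyDiscontinuousSMul Γ.op G] [CompactSpace (G ⧸ Γ)] [MeasurableSpace (G ⧸ Γ)]
    [BorelSpace (G ⧸ Γ)] (μ : Measure (G ⧸ Γ)) [IsFiniteMeasure μ] {f : G → ℂ}
    (hfc : Continuous f) (hfs : HasCompactSupport f) :
    IsCompactOperator (integralOp μ (kernelCont hfc hfs)) :=
  isCompactOperator_integralOp μ _

/-- The same operator on points: a.e. the integral `x̄ ↦ ∫ kernelQuot Γ f x̄ ȳ * v ȳ dμ(ȳ)`. -/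
theorem coeFn_integralOp_kernelCont [WeaklyLocallyCompactSpace G]
    [ProperlyDiscontinuousSMul Γ.op G] [CompactSpace (G ⧸ Γ)] [MeasurableSpace (G ⧸ Γ)]
    [BorelSpace (G ⧸ Γ)] (μ : Measure (G ⧸ Γ)) [IsFiniteMeasure μ] {f : G → ℂ}
    (hfc : Continuous f) (hfs : HasCompactSupport f) (v : Lp ℂ 2 μ) :
    (integralOp μ (kernelCont hfc hfs) v : G ⧸ Γ → ℂ) =ᵐ[μ]
      fun x => ∫ y, kernelQuot Γ f x y * v y ∂μ :=
  coeFn_integralOp μ _ v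

end Summit.Ventures.HodgeRepro2.T5AutomorphizeKernel
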